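import Summits.AtomisticToContinuum.Crystallization.Theorems.FrustratedLawDichotomyStrainedPatchHomEntrySemantic
import Summits.AtomisticToContinuum.Crystallization.Theorems.FrustratedLawDichotomyStrainedPatchHomEntryMirrorHcp

/-!
(SPLIT FOR THE 400-LINE CAP by the landing lane, hand-2 g39: this file = part 1 of 3; sequels `…FrustratedLawDichotomyStrainedPatchHomEntrySemanticQuotB`, `…FrustratedLawDichotomyStrainedPatchHomEntrySemanticQuot` import it in a chain; same namespace, all FQNs unchanged.)
# The hcp semantic currency on the FULL `D₃ₕ` orbit quotient, with the reflections realised as `U`-SPACE WALLS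

Node of the `decomp-a2c` root decomposition (lens 5, generation 88), answering critic row 1484 (E)(a): *is the ×12 hcp point-group
quotient legitimate for `(H) HomFloor` AS TYPED?*

## What the tree has (exact)
* The hcp root hypothesis of the consumer of record (`…F6pT26…_record`, its input `homFloor_of_entryTree6RBKP4_semOKH`) is ONE semantic fact
  `semOKH μ rootCH rootWH = true` (`…HomEntrySemantic`).  Its pointwise content carries the two reflections `F₀ : ξ₀ ↦ −ξ₀`, `F₂ : ξ₂ ↦ −ξ₂`
  as the SHUFFLE-SPACE sign conditions `0 ≤ ξ₀`, `0 ≤ ξ₂` (×4, `…HomEntryFlipHcp.hcpHalf_of_shufSigned`) — and nothing else.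
* The `D₃` wedge `3 ξ₁² ≤ ξ₀²` (×3 more, `…HomEntryMirrorHcp.hcpHalf_of_shufWedge / hcpHalf_of_entryTreeWedge`) is landed ONLY in the
  `treeOK` currency (`entryLeafOKHCW`, `homFloor_of_entryTrees6RBKP_HCW`); it does not compose with the `semOKH` root (no wedge hypothesis in
  `semOKH`; cut / anti-box / level algebra is currency-specific).
* Every quotient the tree has is a condition on `ξ`.  But every expensive hcp cell is a SHEET cell, centred at `ξ = ξ⋆(U)`; by the `D₃ₕ`
  selection rule the sheet's `ξ₂`-response carries no linear term (`ξ⋆₂ = 1.6e-5 … 3.1e-4` on the worst-ray cells `cT030 … cT080` of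
  `…HomEntryFitToleranceA`, against the shuffle half-width `1.25e-3` of `…CellB08M1.wB08M`), so EVERY sheet cell straddles the wall `ξ₂ = 0`
  out to `≈ 1.3 t_b`: the `F₂` half of the ×4 prunes no sheet column at all, and the `F₀` wall `ξ₀ = 0` contains the worst-ray arm's sheet
  image (`ξ⋆₀ = 0`), so both members of an off-arm pair `u₀₁ ↔ −u₀₁` are kept while `|0.86 u₀₁| < 1.7e-3`.  The census prices the hcp side
  with `sym = 4` over `U`-DIRECTIONS (`census/data/budget8/bint9.py`): one column per orbit of `{1, F₀, F₂, F₀F₂}`.  As typed, the root path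
  delivers ≈ 2 columns per orbit on the sheet, not 1 — unless facts are TRANSPORTED between conjugate columns, which no landed lemma does in
  the semantic currency.

## What this file adds (complete proofs, no placeholders; additive; nothing landed is modified)
§1  `HcpLeafGoal μ` IS `HcpDich (μ/SC/2 − e_W)`; hence the leaf conclusion TRANSPORTS under `F₀`, `F₂` and the mirror `S` (from the landed
    `hcpDich_of_flip`, `hcpDich_of_mir`).
§2  ★★ A NEW FUNDAMENTAL DOMAIN for `D₃ₕ` acting on pairs `(U, ξ)`: the two reflections as the `0`-ALIGNED ENTRY WALLS `0 ≤ u₀₁` (`F₀`) and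
    `u₁₂ ≤ 0` (`F₂`) — coordinate hyperplanes through `U* = 1`, hence faces of the dyadic root grid: NO cell straddles them, the ×4 is exact on
    every column, sheet or not — and the rotation subgroup `C₃` as the 120° SHUFFLE SECTOR `Σ = {ξ₁ ≤ 0, ξ₀² ≤ 3 ξ₁²}` (invariant under both
    flips; the worst-ray arm's sheet image `ξ⋆ ∝ (0, −1, ·)` lies on its axis, the other two arms' images 60° outside its walls):
    `hcpHalf_of_sector` (×3), `hcpHalf_of_quotU` (×12).  Proof: `C₃ = {1, F₀S, SF₀}` by two-step transports + `sector_trichotomy`; then `F₀`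
    (negates `u₀₁`, keeps `u₁₂`, keeps `Σ`), then `F₂` (negates `u₁₂`, keeps `u₀₁`, keeps `Σ`) — `…SignKit.flip_entry`.
§3  ★ THE SEMANTIC CURRENCY `semOKHQ μ c w` over that domain (hypotheses: self-adjoint, positive, `‖U − 1‖ ≤ 1/4`, `‖ξ‖ ≤ 1/4`, box, `ξ ∈ Σ`;
    NO sign hypothesis on `ξ₀`, `ξ₂`, none on `U` — the entry walls live in the ROOT BOX) with the full algebra of `semOKH`: intro / elim,
    level antitone, box antitone, cut glue at arbitrary integer points, midpoint halves.
§4  Vacuous leaves: `sectorOut` (box outside `Σ`), `ballOut` (box outside the ball `‖ξ‖ ≤ 1/4` — new, enabled by the `‖ξ‖` hypothesis);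
    §4b trees over the quotient: `semOKHQ_of_sound` (any verdict sound in the QUOTIENT shape — the slot for a sign-free production verdict),
    `semOKHQ_of_sound_pos` (old-shape verdicts on `(+,+)` boxes), `quotLeaf v = sectorOut ∨ ballOut ∨ v`, `semOKHQ_of_treeOK`,
    `treeOK_of_guard` (re-validate an evaluated tree for another verdict by a cheap guard tree, e.g. `!shufOut`).
§5  CONVERSIONS from landed facts: a `semOKH` box inside `{ξ₀ ≥ 0, ξ₂ ≥ 0}` is a `semOKHQ` box (`semOKHQ_of_semOKH_pos`); the FOUR `semOKH`
    facts at a box and its three flipped images (`flipC 0`, `flipC 2`, both) give the `semOKHQ` fact at the box (`semOKHQ_of_semOKH_quad`,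
    the transport the old currency lacked); the old ROOT fact gives every `semOKHQ` fact (`semOKHQ_of_semOKH_root`) — so the new root
    hypothesis is implied by the old one (CONTAINMENT).
§6  ★★★ ROOT CONSUMERS on the QUARTER ROOT BOX `rootCHQ / rootWHQ` (`u₀₁ ∈ [0, 1/4]`, `u₁₂ ∈ [−1/4, 0]`, all other coordinates as `rootCH /
    rootWH`): `hcpHalf_of_semOKHQ`, `homFloor_of_entryTree6RBKP4_semOKHQ` (the `(H)` input of the consumers of record, VERBATIM shape),
    `homFloor_of_entryTree6RBKP4_treeQ` (hcp side as any `treeOK` tree on the quarter box), `semOKHQ_root_of_semOKH_root`.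
§7  Kernel smoke tests of the prunes (`decide` on small integer boxes).

## Piece tags (for the critic)
* §1, §3, §5, §6: glue — COSTUME-free bookkeeping, each statement strictly weaker than (implied by) its `semOKH` counterpart or a tautology
  of the definitions; §2: the one mathematical step (elementary: a fundamental domain of a 12-element group), PROVED here.
* INSTRUMENTABLE leaf (census ask QUOT-88): per `V₄`-orbit of hard `U`-columns, (i) how many columns have a sheet cell meeting
  `{ξ₀ ≥ 0, ξ₂ ≥ 0}` under the typed root (expected ≈ 2), vs exactly 1 under `rootCHQ/rootWHQ`; (ii) the fraction of cap / bulk columns whose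
  sheet cell meets `∂Σ` (where the ×3 is not realised; expected: columns with `|ξ⋆_∥| sin 60° < 2.6e-3`, i.e. `t ≲ 0.42 t_b` on the arms).
* SIGN-FREENESS OF THE PRODUCTION CHAIN (read from the tree, decides the former ask SIGNFREE-88): in the hcp soundness chain the signs
  `h0 : 0 ≤ ξ₀`, `h2 : 0 ≤ ξ₂` are CONSUMED ONLY by the vacuous prune `false_of_shufOut` (`…HomEntryTableHcpV` l.191, `…HomEntryTableHcp`
  l.228 / l.316) and merely FORWARDED by the slab wrappers (`…HomEntryLeafHTA2Q.entryLeafOKHT4A2Q_sound` l.134 binders, l.263–271) and by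
  `…FitHcpCentredSqSound.entryLeafOKHQDCRS_sound` (third disjunct only); every substantive component is called WITHOUT them —
  `fitOKHDCRS_sound`, `fitOKHDM_sound` (l.296–297 there), `tableLeafOKHV_sound`, `tableLeafOKHW_sound`, `radOKH_sound`, `entryLeafOKH3R_sound`,
  `hver_of_slabParts`; the exterior / annulus / cell-backed leaves carry them UNDERSCORED-UNUSED (`exteriorOK2_sound`, `annulusOK2_sound`,
  `exteriorOK3_sound_far`: `_h0 _h2`).  Hence the quotient-shape production verdict is the verdict of record with `shufOut` replaced by
  `sectorOut ∨ ballOut` and the two binders deleted — a MECHANICAL port (hand-2; no new mathematics, no new kernel facts for cells whose inner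
  side is sign-free, e.g. the `0.8 t_b` cell `cT080 × wB08M` whose inner side is ONE `fitOKHDCRS` leaf, `…CellB08M1` docstring), after which
  `semOKHQ_of_sound` / `semOKHQ_of_treeOK` make ONE kernel evaluation per orbit a `semOKHQ` fact.  What is NOT free: inner trees that accepted
  `ξ₂ < 0` sub-boxes of a straddling cell BY `shufOut` must certify them for real under the quotient verdict (inner work ≤ ×2 on exactly those
  cells; which `t`-bands use multi-leaf inner trees is census ask QUOT-88 (iii)).
-/

noncomputable section

namespace Summit.AtomisticToContinuum.Crystallization.Theorems.FrustratedLawDichotomyStrainedPatchHomEntrySemanticQuot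

open scoped BigOperators RealInnerProductSpace
open Literature.Analysis.ValidatedNumerics.Numerics
open Summit.AtomisticToContinuum.Crystallization.Theorems.ChargedEnergyGapNegative (E3)
open Summit.AtomisticToContinuum.Crystallization.Theorems.FrustratedLawDichotomySchurCut (effPot w₄₅ ω₄)
open Summit.AtomisticToContinuum.Crystallization.Theorems.FrustratedLawDichotomyAveragingRuleTightFree (TightNearCap BadNearCap)
open Summit.AtomisticToContinuum.Crystallization.Theorems.FrustratedLawDichotomyExemptAbsorption (ExemptNear)
open Summit.AtomisticToContinuum.Crystallization.Theorems.FrustratedLawDichotomyStrainedPatchHomSplit (ExRec latPt hexFrame hcpShift HomFloor)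
open Summit.AtomisticToContinuum.Crystallization.Theorems.FrustratedLawDichotomyStrainedPatchHomCover (shuffle_mem_rootCube)
open Summit.AtomisticToContinuum.Crystallization.Theorems.FrustratedLawDichotomyStrainedPatchHomPrunedPolar (homFloor_of_prunedBoxSums_selfAdjoint)
open Summit.AtomisticToContinuum.Crystallization.Theorems.FrustratedLawDichotomyStrainedPatchHomCertTree (CertTree treeOK)
open Summit.AtomisticToContinuum.Crystallization.Theorems.FrustratedLawDichotomyStrainedPatchHomEntryGram (rootC rootW rootW_div mem_root_of_near_one)
open Summit.AtomisticToContinuum.Crystallization.Theorems.FrustratedLawDichotomyStrainedPatchHomEntryGramHcp (rootCH rootWH)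
open Summit.AtomisticToContinuum.Crystallization.Theorems.FrustratedLawDichotomyStrainedPatchHomEntrySignKit (flipIso flipIso_apply flip_entry conjIso_selfAdjoint conjIso_pos conjIso_norm_sub_one_le)
open Summit.AtomisticToContinuum.Crystallization.Theorems.FrustratedLawDichotomyStrainedPatchHomEntryFlipHcp (HcpDich hcpDich_of_flip)
open Summit.AtomisticToContinuum.Crystallization.Theorems.FrustratedLawDichotomyStrainedPatchHomEntryMirrorHcpKit (mirIso mirIso_apply)
open Summit.AtomisticToContinuum.Crystallization.Theorems.FrustratedLawDichotomyStrainedPatchHomEntryMirrorHcp (hcpDich_of_mir)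
open Summit.AtomisticToContinuum.Crystallization.Theorems.FrustratedLawDichotomyStrainedPatchHomEntryLeafHT (hcpCoord HcpLeafGoal inHcpBox_iff hcpLeafGoal_mono semOKH semOKH_forall semOKH_of_sound abs_sub_div_le_of_contained abs_sub_div_le_or_of_cut entryLeafOK6RBKP4 fccHalf_of_entryTree6RBKP4 hcpHalf_of_semOKH)

/-! ## §1. The leaf conclusion is the dichotomy at floor `μ/SC/2 − e_W`; transports under `F₀`, `F₂`, `S` -/

/-- `HcpLeafGoal μ U ξ ↔ HcpDich (μ/SC/2 − e_W) U ξ`. [arithmetic] -/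
theorem hcpLeafGoal_iff_hcpDich (μ : ℤ) (U : E3 →L[ℝ] E3) (ξ : E3) :
    HcpLeafGoal μ U ξ ↔ HcpDich ((μ : ℝ) / SC / 2 - (-(7175 / 10000) + 3 / 400)) U ξ := by
  unfold HcpLeafGoal HcpDich
  refine or_congr Iff.rfl ⟨fun h => ?_, fun h => ?_⟩
  · linarith
  · linarith

/-- The leaf conclusion at level `μ` gives the dichotomy at every floor `m` with `2 (m + e_W) SC ≤ μ`. [arithmetic] -/
theorem hcpDich_of_hcpLeafGoal {m : ℝ} {μ : ℤ} (hμ : 2 * (m + (-(7175 / 10000) + 3 / 400)) * SC ≤ μ) {U : E3 →L[ℝ] E3} {ξ : E3}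
    (h : HcpLeafGoal μ U ξ) : HcpDich m U ξ := by
  have hS : (0 : ℝ) < SC := SC_pos
  have h2 : 2 * (m + (-(7175 / 10000) + 3 / 400)) ≤ (μ : ℝ) / SC := by rw [le_div_iff₀ hS]; exact hμ
  rcases h with h | h
  · exact Or.inl h
  · right
    linarith

/-- ★ TRANSPORT UNDER A COORDINATE FLIP `Fᵢ` (`i ∈ {0, 2}`): the leaf conclusion for `(Fᵢ U Fᵢ, Fᵢ ξ)` gives it for `(U, ξ)`. [folklore] -/
theorem hcpLeafGoal_of_flip {i : Fin 3} (hi : i = 0 ∨ i = 2) {μ : ℤ} (U : E3 →L[ℝ] E3) (ξ : E3) (hU : ‖U - 1‖ ≤ 1 / 4) (hξ : ‖ξ‖ ≤ 1 / 4)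
    (h : HcpLeafGoal μ ((flipIso i : E3 →L[ℝ] E3).comp (U.comp ((flipIso i).symm : E3 →L[ℝ] E3))) (flipIso i ξ)) : HcpLeafGoal μ U ξ :=
  (hcpLeafGoal_iff_hcpDich μ U ξ).2 (hcpDich_of_flip hi U ξ hU hξ ((hcpLeafGoal_iff_hcpDich μ _ _).1 h))

/-- ★ TRANSPORT UNDER THE MIRROR `S`: the leaf conclusion for `(S U S, S ξ)` gives it for `(U, ξ)`. [folklore] -/
theorem hcpLeafGoal_of_mir {μ : ℤ} (U : E3 →L[ℝ] E3) (ξ : E3) (hU : ‖U - 1‖ ≤ 1 / 4) (hξ : ‖ξ‖ ≤ 1 / 4)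
    (h : HcpLeafGoal μ ((mirIso : E3 →L[ℝ] E3).comp (U.comp (mirIso.symm : E3 →L[ℝ] E3))) (mirIso ξ)) : HcpLeafGoal μ U ξ :=
  (hcpLeafGoal_iff_hcpDich μ U ξ).2 (hcpDich_of_mir U ξ hU hξ ((hcpLeafGoal_iff_hcpDich μ _ _).1 h))

/-- Data of a conjugate `P U P⁻¹`: self-adjoint, positive, `‖· − 1‖ ≤ 1/4`. [formal bookkeeping] -/
theorem conj_data (P : E3 ≃ₗᵢ[ℝ] E3) {V : E3 →L[ℝ] E3} (hVsa : ∀ v w : E3, inner ℝ (V v) w = inner ℝ v (V w)) (hVpos : ∀ w : E3, 0 ≤ inner ℝ w (V w))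
    (hV : ‖V - 1‖ ≤ 1 / 4) :
    (∀ v w : E3, inner ℝ (((P : E3 →L[ℝ] E3).comp (V.comp (P.symm : E3 →L[ℝ] E3))) v) w =
        inner ℝ v (((P : E3 →L[ℝ] E3).comp (V.comp (P.symm : E3 →L[ℝ] E3))) w)) ∧
      (∀ w : E3, 0 ≤ inner ℝ w (((P : E3 →L[ℝ] E3).comp (V.comp (P.symm : E3 →L[ℝ] E3))) w)) ∧
      ‖(P : E3 →L[ℝ] E3).comp (V.comp (P.symm : E3 →L[ℝ] E3)) - 1‖ ≤ 1 / 4 :=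
  ⟨conjIso_selfAdjoint P hVsa, conjIso_pos P hVpos, (conjIso_norm_sub_one_le P V).trans hV⟩

/-- `‖P η‖ ≤ 1/4` from `‖η‖ ≤ 1/4`. [formal bookkeeping] -/
theorem norm_iso_le (P : E3 ≃ₗᵢ[ℝ] E3) {η : E3} (hη : ‖η‖ ≤ 1 / 4) : ‖P η‖ ≤ 1 / 4 := by rwa [LinearIsometryEquiv.norm_map]

/-- Coordinates `0, 1, 2` of `F₀ η` and `F₂ η`. [formal bookkeeping] -/
theorem flip0_coords (η : E3) : (flipIso 0 η) 0 = -η 0 ∧ (flipIso 0 η) 1 = η 1 ∧ (flipIso 0 η) 2 = η 2 :=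
  ⟨by rw [flipIso_apply]; simp, by rw [flipIso_apply]; simp, by rw [flipIso_apply]; simp⟩

/-- Coordinates of the reflection `flipIso 2`: `(η₀, η₁, −η₂)` (lane docstring, hand-2 g39). -/
theorem flip2_coords (η : E3) : (flipIso 2 η) 0 = η 0 ∧ (flipIso 2 η) 1 = η 1 ∧ (flipIso 2 η) 2 = -η 2 :=
  ⟨by rw [flipIso_apply]; simp, by rw [flipIso_apply]; simp, by rw [flipIso_apply]; simp⟩

/-- The WALL ENTRIES under the flips: `F₀` negates `u₀₁` and keeps `u₁₂`; `F₂` keeps `u₀₁` and negates `u₁₂`. [formal bookkeeping] -/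
theorem flip_wall_entries (V : E3 →L[ℝ] E3) :
    (((flipIso 0 : E3 →L[ℝ] E3).comp (V.comp ((flipIso 0).symm : E3 →L[ℝ] E3))) (EuclideanSpace.single 1 (1 : ℝ))) 0 =
        -(V (EuclideanSpace.single 1 (1 : ℝ))) 0 ∧
      (((flipIso 0 : E3 →L[ℝ] E3).comp (V.comp ((flipIso 0).symm : E3 →L[ℝ] E3))) (EuclideanSpace.single 2 (1 : ℝ))) 1 =
        (V (EuclideanSpace.single 2 (1 : ℝ))) 1 ∧
      (((flipIso 2 : E3 →L[ℝ] E3).comp (V.comp ((flipIso 2).symm : E3 →L[ℝ] E3))) (EuclideanSpace.single 1 (1 : ℝ))) 0 =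
        (V (EuclideanSpace.single 1 (1 : ℝ))) 0 ∧
      (((flipIso 2 : E3 →L[ℝ] E3).comp (V.comp ((flipIso 2).symm : E3 →L[ℝ] E3))) (EuclideanSpace.single 2 (1 : ℝ))) 1 =
        -(V (EuclideanSpace.single 2 (1 : ℝ))) 1 := by
  refine ⟨?_, ?_, ?_, ?_⟩ <;> rw [flip_entry] <;> simp

/-! ## §2. The fundamental domain: `C₃` as the shuffle sector `Σ`, the reflections as entry walls -/

/-- ★ SECTOR TRICHOTOMY: every point of the `ξ_∥`-plane lies in `Σ = {b ≤ 0, a² ≤ 3 b²}`, or its image under the rotation `F₀ S`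
(`(a, b) ↦ (−(a/2 − (√3/2) b), −(√3/2) a − b/2)`) does, or its image under `S F₀` (`(a, b) ↦ (−a/2 − (√3/2) b, −(√3/2)(−a) − b/2)`) does —
the three 120° sectors cover the plane.  (Stated in the literal coordinate shapes produced by `mirIso_apply` / `flipIso_apply`.) [arithmetic] -/
theorem sector_trichotomy (a b : ℝ) :
    (b ≤ 0 ∧ a ^ 2 ≤ 3 * b ^ 2) ∨
      (-(Real.sqrt 3 / 2) * a - b / 2 ≤ 0 ∧ (-(a / 2 - Real.sqrt 3 / 2 * b)) ^ 2 ≤ 3 * (-(Real.sqrt 3 / 2) * a - b / 2) ^ 2) ∨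
      (-(Real.sqrt 3 / 2) * -a - b / 2 ≤ 0 ∧ (-a / 2 - Real.sqrt 3 / 2 * b) ^ 2 ≤ 3 * (-(Real.sqrt 3 / 2) * -a - b / 2) ^ 2) := by
  set s := Real.sqrt 3 with hs_def
  have hs3 : s * s = 3 := Real.mul_self_sqrt (by norm_num)
  have hs0 : 0 < s := Real.sqrt_pos.mpr (by norm_num)
  have hs1 : 1 < s := by nlinarith
  by_cases hA : b ≤ 0 ∧ a ^ 2 ≤ 3 * b ^ 2
  · exact Or.inl hA
  rw [not_and_or, not_le, not_le] at hA
  by_cases ha : 0 ≤ a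
  · -- rotate by `F₀ S`
    right; left
    have hab : 0 ≤ a + s * b ∧ 0 ≤ s * a + b := by
      rcases hA with hb | hb
      · exact ⟨by nlinarith, by nlinarith⟩
      · rcases le_or_gt b 0 with hb' | hb'
        · -- `b ≤ 0`, `a² > 3 b² = (s b)²` with `a ≥ 0`, `−s b ≥ 0` ⇒ `a > −s b`
          have hsb : 0 ≤ -(s * b) := by nlinarith
          have hlt : (-(s * b)) ^ 2 < a ^ 2 := by nlinarith
          have hgt : -(s * b) < a := by
            by_contra hcon
            push Not at hcon
            nlinarith
          exact ⟨by linarith, by nlinarith⟩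
        · exact ⟨by nlinarith, by nlinarith⟩
    refine ⟨by nlinarith [hab.2], ?_⟩
    have key : 3 * (-(s / 2) * a - b / 2) ^ 2 - (-(a / 2 - s / 2 * b)) ^ 2 = 2 * a * (a + s * b) := by
      linear_combination (3 * a ^ 2 / 4 - b ^ 2 / 4) * hs3
    nlinarith [mul_nonneg ha hab.1]
  · -- rotate by `S F₀`
    right; right
    have ha' : a < 0 := lt_of_not_ge ha
    have hab : 0 ≤ s * b - a ∧ 0 ≤ b - s * a := by
      rcases hA with hb | hb
      · exact ⟨by nlinarith, by nlinarith⟩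
      · rcases le_or_gt b 0 with hb' | hb'
        · have hsb : 0 ≤ -(s * b) := by nlinarith
          have hlt : (-(s * b)) ^ 2 < (-a) ^ 2 := by nlinarith
          have hgt : -(s * b) < -a := by
            by_contra hcon
            push Not at hcon
            nlinarith
          exact ⟨by linarith, by nlinarith⟩
        · exact ⟨by nlinarith, by nlinarith⟩
    refine ⟨by nlinarith [hab.2], ?_⟩
    have key : 3 * (-(s / 2) * -a - b / 2) ^ 2 - (-a / 2 - s / 2 * b) ^ 2 = 2 * (-a) * (s * b - a) := by
      linear_combination (3 * a ^ 2 / 4 - b ^ 2 / 4) * hs3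
    nlinarith [mul_nonneg (neg_nonneg.mpr ha'.le) hab.1]

/-- ★★ **REDUCTION TO THE SECTOR `Σ` (×3, the rotation subgroup `C₃ = {1, F₀S, SF₀}`).**  If the hcp dichotomy holds for every self-adjoint
positive `U` with `‖U − 1‖ ≤ 1/4` and every `ξ` with `‖ξ‖ ≤ 1/4`, `ξ₁ ≤ 0`, `ξ₀² ≤ 3 ξ₁²`, it holds for every such `U` and EVERY `ξ` with
`‖ξ‖ ≤ 1/4`. [folklore] -/
theorem hcpHalf_of_sector {m : ℝ}
    (h : ∀ (U : E3 →L[ℝ] E3) (ξ : E3), (∀ v w : E3, inner ℝ (U v) w = inner ℝ v (U w)) → (∀ w : E3, 0 ≤ inner ℝ w (U w)) →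
      ‖U - 1‖ ≤ 1 / 4 → ‖ξ‖ ≤ 1 / 4 → ξ 1 ≤ 0 → (ξ 0) ^ 2 ≤ 3 * (ξ 1) ^ 2 → HcpDich m U ξ) :
    ∀ (U : E3 →L[ℝ] E3) (ξ : E3), (∀ v w : E3, inner ℝ (U v) w = inner ℝ v (U w)) → (∀ w : E3, 0 ≤ inner ℝ w (U w)) →
      ‖U - 1‖ ≤ 1 / 4 → ‖ξ‖ ≤ 1 / 4 → HcpDich m U ξ := by
  intro U ξ hsa hpos hU hξ
  rcases sector_trichotomy (ξ 0) (ξ 1) with ⟨hb, hab⟩ | ⟨hb, hab⟩ | ⟨hb, hab⟩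
  · exact h U ξ hsa hpos hU hξ hb hab
  · -- `F₀ S`: `HcpDich U ξ ⟸ S ⟸ F₀`
    obtain ⟨s1, p1, n1⟩ := conj_data mirIso hsa hpos hU
    obtain ⟨s2, p2, n2⟩ := conj_data (flipIso 0) s1 p1 n1
    have hξ1 := norm_iso_le mirIso hξ
    have hξ2 := norm_iso_le (flipIso 0) hξ1
    obtain ⟨m0, m1, -⟩ := mirIso_apply ξ
    obtain ⟨a0, a1, -⟩ := flip0_coords (mirIso ξ)
    refine hcpDich_of_mir U ξ hU hξ (hcpDich_of_flip (Or.inl rfl) _ _ n1 hξ1 (h _ _ s2 p2 n2 hξ2 ?_ ?_))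
    · rw [a1, m1]; exact hb
    · rw [a0, a1, m0, m1]; exact hab
  · -- `S F₀`: `HcpDich U ξ ⟸ F₀ ⟸ S`
    obtain ⟨s1, p1, n1⟩ := conj_data (flipIso 0) hsa hpos hU
    obtain ⟨s2, p2, n2⟩ := conj_data mirIso s1 p1 n1
    have hξ1 := norm_iso_le (flipIso 0) hξ
    have hξ2 := norm_iso_le mirIso hξ1
    obtain ⟨a0, a1, -⟩ := flip0_coords ξ
    obtain ⟨m0, m1, -⟩ := mirIso_apply (flipIso 0 ξ)
    refine hcpDich_of_flip (Or.inl rfl) U ξ hU hξ (hcpDich_of_mir _ _ n1 hξ1 (h _ _ s2 p2 n2 hξ2 ?_ ?_))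
    · rw [m1, a0, a1]; exact hb
    · rw [m0, m1, a0, a1]; exact hab

/-- ★★ **REDUCTION TO THE FULL FUNDAMENTAL DOMAIN (×12): the sector `Σ` in `ξ`, the reflections as the ENTRY WALLS `0 ≤ u₀₁`, `u₁₂ ≤ 0`.**
If the hcp dichotomy holds for every self-adjoint positive `U` with `‖U − 1‖ ≤ 1/4`, `0 ≤ (U e₁)₀`, `(U e₂)₁ ≤ 0` and every `ξ ∈ Σ` with
`‖ξ‖ ≤ 1/4`, it holds for every such `U` and every `ξ` with `‖ξ‖ ≤ 1/4`.  (`F₀` negates `u₀₁`, keeps `u₁₂` and `Σ`; `F₂` negates `u₁₂`, keeps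
`u₀₁` and `Σ`.) [folklore] -/
theorem hcpHalf_of_quotU {m : ℝ}
    (h : ∀ (U : E3 →L[ℝ] E3) (ξ : E3), (∀ v w : E3, inner ℝ (U v) w = inner ℝ v (U w)) → (∀ w : E3, 0 ≤ inner ℝ w (U w)) →
      ‖U - 1‖ ≤ 1 / 4 → ‖ξ‖ ≤ 1 / 4 → 0 ≤ (U (EuclideanSpace.single 1 (1 : ℝ))) 0 → (U (EuclideanSpace.single 2 (1 : ℝ))) 1 ≤ 0 →
      ξ 1 ≤ 0 → (ξ 0) ^ 2 ≤ 3 * (ξ 1) ^ 2 → HcpDich m U ξ) :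
    ∀ (U : E3 →L[ℝ] E3) (ξ : E3), (∀ v w : E3, inner ℝ (U v) w = inner ℝ v (U w)) → (∀ w : E3, 0 ≤ inner ℝ w (U w)) →
      ‖U - 1‖ ≤ 1 / 4 → ‖ξ‖ ≤ 1 / 4 → HcpDich m U ξ := by
  refine hcpHalf_of_sector fun U ξ hsa hpos hU hξ hb hab => ?_
  -- step `F₂`: reduce to `u₁₂ ≤ 0` given `u₀₁ ≥ 0`
  have step : ∀ (V : E3 →L[ℝ] E3) (η : E3), (∀ v w : E3, inner ℝ (V v) w = inner ℝ v (V w)) → (∀ w : E3, 0 ≤ inner ℝ w (V w)) →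
      ‖V - 1‖ ≤ 1 / 4 → ‖η‖ ≤ 1 / 4 → η 1 ≤ 0 → (η 0) ^ 2 ≤ 3 * (η 1) ^ 2 → 0 ≤ (V (EuclideanSpace.single 1 (1 : ℝ))) 0 → HcpDich m V η := by
    intro V η hVsa hVpos hV hη hb' hab' h01
    by_cases h12 : (V (EuclideanSpace.single 2 (1 : ℝ))) 1 ≤ 0
    · exact h V η hVsa hVpos hV hη h01 h12 hb' hab'
    · obtain ⟨s1, p1, n1⟩ := conj_data (flipIso 2) hVsa hVpos hV
      obtain ⟨-, -, e01, e12⟩ := flip_wall_entries V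
      obtain ⟨c0, c1, -⟩ := flip2_coords η
      refine hcpDich_of_flip (Or.inr rfl) V η hV hη (h _ _ s1 p1 n1 (norm_iso_le (flipIso 2) hη) ?_ ?_ ?_ ?_)
      · rw [e01]; exact h01
      · rw [e12]; linarith [lt_of_not_ge h12]
      · rw [c1]; exact hb'
      · rw [c0, c1]; exact hab'
  by_cases h01 : 0 ≤ (U (EuclideanSpace.single 1 (1 : ℝ))) 0
  · exact step U ξ hsa hpos hU hξ hb hab h01
  · obtain ⟨s1, p1, n1⟩ := conj_data (flipIso 0) hsa hpos hU
    obtain ⟨e01, -, -, -⟩ := flip_wall_entries U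
    obtain ⟨c0, c1, -⟩ := flip0_coords ξ
    refine hcpDich_of_flip (Or.inl rfl) U ξ hU hξ (step _ _ s1 p1 n1 (norm_iso_le (flipIso 0) hξ) ?_ ?_ ?_)
    · rw [c1]; exact hb
    · rw [c0, c1, neg_sq]; exact hab
    · rw [e01]; linarith [lt_of_not_ge h01]

/-! ## §3. The semantic currency over the fundamental domain -/

/-- ★ **THE SEMANTIC hcp BOX VERDICT ON THE ORBIT QUOTIENT at level `μ`**: the leaf conclusion holds at every self-adjoint positive `U` with
`‖U − 1‖ ≤ 1/4` and every `ξ` with `‖ξ‖ ≤ 1/4` of the box whose shuffle lies in the sector `Σ = {ξ₁ ≤ 0, ξ₀² ≤ 3 ξ₁²}`.  NO sign hypothesis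
on `ξ₀, ξ₂`; the reflections are discharged by the entry walls of the quarter ROOT box (§6).  Classical `decide`, never kernel-evaluated. -/
def semOKHQ (μ : ℤ) (c w : (Fin 3 × Fin 3) ⊕ Fin 3 → ℤ) : Bool :=
  @decide (∀ (U : E3 →L[ℝ] E3) (ξ : E3), (∀ v v' : E3, ⟪U v, v'⟫ = ⟪v, U v'⟫) → (∀ v : E3, 0 ≤ ⟪v, U v⟫) → ‖U - 1‖ ≤ 1 / 4 → ‖ξ‖ ≤ 1 / 4 →
      (∀ k, |hcpCoord U ξ k - (c k : ℝ) / SC| ≤ (w k : ℝ) / SC) → ξ 1 ≤ 0 → (ξ 0) ^ 2 ≤ 3 * (ξ 1) ^ 2 → HcpLeafGoal μ U ξ)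
    (Classical.propDecidable _)

/-- Introduction. [formal bookkeeping] -/
theorem semOKHQ_of_forall {μ : ℤ} {c w : (Fin 3 × Fin 3) ⊕ Fin 3 → ℤ}
    (h : ∀ (U : E3 →L[ℝ] E3) (ξ : E3), (∀ v v' : E3, ⟪U v, v'⟫ = ⟪v, U v'⟫) → (∀ v : E3, 0 ≤ ⟪v, U v⟫) → ‖U - 1‖ ≤ 1 / 4 → ‖ξ‖ ≤ 1 / 4 →
      (∀ k, |hcpCoord U ξ k - (c k : ℝ) / SC| ≤ (w k : ℝ) / SC) → ξ 1 ≤ 0 → (ξ 0) ^ 2 ≤ 3 * (ξ 1) ^ 2 → HcpLeafGoal μ U ξ) :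
    semOKHQ μ c w = true :=
  @decide_eq_true _ (Classical.propDecidable _) h

/-- Elimination. [formal bookkeeping] -/
theorem semOKHQ_forall {μ : ℤ} {c w : (Fin 3 × Fin 3) ⊕ Fin 3 → ℤ} (h : semOKHQ μ c w = true) :
    ∀ (U : E3 →L[ℝ] E3) (ξ : E3), (∀ v v' : E3, ⟪U v, v'⟫ = ⟪v, U v'⟫) → (∀ v : E3, 0 ≤ ⟪v, U v⟫) → ‖U - 1‖ ≤ 1 / 4 → ‖ξ‖ ≤ 1 / 4 →
      (∀ k, |hcpCoord U ξ k - (c k : ℝ) / SC| ≤ (w k : ℝ) / SC) → ξ 1 ≤ 0 → (ξ 0) ^ 2 ≤ 3 * (ξ 1) ^ 2 → HcpLeafGoal μ U ξ :=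
  @of_decide_eq_true _ (Classical.propDecidable _) h

/-- ★ LEVEL ANTITONICITY. [formal bookkeeping] -/
theorem semOKHQ_mono_level {μ μ' : ℤ} (hle : μ' ≤ μ) {c w : (Fin 3 × Fin 3) ⊕ Fin 3 → ℤ} (h : semOKHQ μ c w = true) : semOKHQ μ' c w = true :=
  semOKHQ_of_forall fun U ξ hsa hpos hU hξ hmem hb hab => hcpLeafGoal_mono hle (semOKHQ_forall h U ξ hsa hpos hU hξ hmem hb hab)

/-- ★ BOX ANTITONICITY: a certified box certifies every box it contains (integer endpoint containment on all twelve coordinates). [formal bookkeeping] -/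
theorem semOKHQ_anti_box {μ : ℤ} {c w c' w' : (Fin 3 × Fin 3) ⊕ Fin 3 → ℤ} (hcont : ∀ k, c k - w k ≤ c' k - w' k ∧ c' k + w' k ≤ c k + w k)
    (h : semOKHQ μ c w = true) : semOKHQ μ c' w' = true :=
  semOKHQ_of_forall fun U ξ hsa hpos hU hξ hmem hb hab =>
    semOKHQ_forall h U ξ hsa hpos hU hξ (fun k => abs_sub_div_le_of_contained (hcont k).1 (hcont k).2 (hmem k)) hb hab

/-- ★★ CUT GLUE AT AN ARBITRARY INTEGER CUT POINT along coordinate `k` (pieces given literally as `Function.update`s). [formal bookkeeping] -/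
theorem semOKHQ_of_cut {μ : ℤ} {c w cl wl cr wr : (Fin 3 × Fin 3) ⊕ Fin 3 → ℤ} (k : (Fin 3 × Fin 3) ⊕ Fin 3) {a b a' b' : ℤ}
    (h1 : a - b = c k - w k) (h2 : a + b = a' - b') (h3 : a' + b' = c k + w k)
    (hcl : cl = Function.update c k a) (hwl : wl = Function.update w k b) (hcr : cr = Function.update c k a') (hwr : wr = Function.update w k b')
    (hl : semOKHQ μ cl wl = true) (hr : semOKHQ μ cr wr = true) : semOKHQ μ c w = true := by
  subst hcl hwl hcr hwr
  refine semOKHQ_of_forall fun U ξ hsa hpos hU hξ hmem hb hab => ?_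
  rcases abs_sub_div_le_or_of_cut h1 h2 h3 (hmem k) with hk | hk
  · refine semOKHQ_forall hl U ξ hsa hpos hU hξ (fun j => ?_) hb hab
    by_cases hj : j = k
    · subst hj; simpa using hk
    · simpa [Function.update_of_ne hj] using hmem j
  · refine semOKHQ_forall hr U ξ hsa hpos hU hξ (fun j => ?_) hb hab
    by_cases hj : j = k
    · subst hj; simpa using hk
    · simpa [Function.update_of_ne hj] using hmem j

/-- MIDPOINT HALVING (the `treeOK` split) is the special cut `p = c_k`. [formal bookkeeping] -/
theorem semOKHQ_of_halves {μ : ℤ} {c w : (Fin 3 × Fin 3) ⊕ Fin 3 → ℤ} (k : (Fin 3 × Fin 3) ⊕ Fin 3) (hev : w k % 2 = 0)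
    (hl : semOKHQ μ (Function.update c k (c k - w k / 2)) (Function.update w k (w k / 2)) = true)
    (hr : semOKHQ μ (Function.update c k (c k + w k / 2)) (Function.update w k (w k / 2)) = true) : semOKHQ μ c w = true := by
  refine semOKHQ_of_cut k (a := c k - w k / 2) (b := w k / 2) (a' := c k + w k / 2) (b' := w k / 2) ?_ ?_ ?_ rfl rfl rfl rfl hl hr <;> omega

end Summit.AtomisticToContinuum.Crystallization.Theorems.FrustratedLawDichotomyStrainedPatchHomEntrySemanticQuot

end
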